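import Summits.HubbardSuperconductivity.HubbardSuperconductivity.Theorems.LogColdTorusLogColdDWaveOrderSectorLogScale
import HarnessLib

/-!
# Route `LogColdTorus`, crux `LogColdDWaveOrder` (stmt-HubbardSuperconductivity-8807):
# the threshold `κ₀` is load-bearing (a refuted strengthening of the crux)

`LogColdDWaveOrder` asks for `∃ κ₀ > 0, ∃ c > 0, ∀ κ ≥ κ₀, …, c·L⁴ ≤ Re ω^{sec}_{κ log L, L}(Δ_d†Δ_d)`.
The `κ`-ceiling `logColdSector_orderConstant_le` (`c ≤ C_d e^{-1/(256κ)}`, sibling file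
`LogColdTorusLogColdDWaveOrderSectorLogScale.lean`) shows that the variant with the threshold removed —
ONE constant `c > 0` serving EVERY `κ > 0` — is false for every `δ` and every `U`-window:
`logColdDWaveOrder_false_without_threshold`. This is Mermin–Wagner read at the Koma–Tasaki threshold
(the rigorous upper half of the route's scaling law `m²(κ) = m_∞² e^{-1/(2πκρ_s)}`); it does not touch
the crux itself, whose `c` may depend on `κ₀`.

Sources: T. Koma, H. Tasaki, PRL 68 (1992) 3248 (Theorem, eqs. (2)–(3)); S. T. Bramwell,
P. C. W. Holdsworth, J. Phys.: Condens. Matter 5 (1993) L53. No definitions.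
-/

-- the mandated namespace `Summit.<Summit>.<Problem>.Theorems` repeats `HubbardSuperconductivity`
-- (single-problem summit, D-0017), which the `dupNamespace` linter flags on every declaration
set_option linter.dupNamespace false

noncomputable section

namespace Summit.HubbardSuperconductivity.HubbardSuperconductivity.Theorems.LogColdTorus

open Matrix Finset Filter NormedSpace Literature.MathematicalPhysics.QuantumLattice
  Literature.Probability.LatticeModels Literature.Barriers.HubbardSuperconductivity
  Summit.HubbardSuperconductivity.HubbardSuperconductivity.Theorems
open scoped Matrix.Norms.L2Operator ComplexOrder Topology

open scoped Classical in
/-- **The threshold `κ₀` of `LogColdDWaveOrder` is load-bearing** (refuted strengthening): it is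
FALSE that one order constant `c > 0` serves EVERY `κ > 0` — i.e. the variant of the crux with
`∃ κ₀ > 0, ∀ κ ≥ κ₀` replaced by `∀ κ > 0` (log-cold `d`-wave order all the way up to the
Koma–Tasaki threshold temperature, with a `κ`-independent constant) fails for every `δ` and every
window, because `c ≤ C_d e^{-1/(256κ)} → 0` as `κ → 0⁺` (`logColdSector_orderConstant_le`).
The crux itself (`κ ≥ κ₀ > 0`, `c` allowed to depend on `κ₀`) is untouched: the scaling law only
caps `c(κ₀) ≤ C_d e^{-1/(256κ₀)}`. [cite: KomaTasakiPRL1992, Theorem eq. (2)–(3)] -/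
theorem logColdDWaveOrder_false_without_threshold :
    ¬ ∃ δ : ℝ, ∃ U₁ U₂ : ℝ, U₁ < U₂ ∧ ∃ c : ℝ, 0 < c ∧ ∀ κ : ℝ, 0 < κ → ∃ L₀ : ℕ,
      ∀ U ∈ Set.Ioo U₁ U₂, ∀ (L : ℕ) [NeZero L], L₀ ≤ L → Even L →
        let p : Finset (Orb (FermionTorus 2 L)) → Prop := fun s =>
          s.card = 2 * ⌊(1 - δ) * (L : ℝ) ^ 2 / 2⌋₊ ∧
            2 * (s.filter fun i => (ofLex i).2 = 0).card = 2 * ⌊(1 - δ) * (L : ℝ) ^ 2 / 2⌋₊;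
        c * (L : ℝ) ^ 4 ≤ (Matrix.gibbsState (κ * Real.log L) ((hubbardTorus 2 L 1 U).toBlock p p)
          (((pairField dWaveFormFactor L)ᴴ * pairField dWaveFormFactor L).toBlock p p)).re := by
  rintro ⟨δ, U₁, U₂, hU, c, hc, h⟩
  have hC0 : 0 ≤ pairFieldDecayConst dWaveFormFactor := pairFieldDecayConst_nonneg _
  -- a `κ` so small that `C e^{-1/(256κ)} < c`: `1/(256κ) = K := max 1 (log(C/c) + 1)`
  obtain ⟨K, hK1, hKlog⟩ : ∃ K : ℝ, 1 ≤ K ∧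
      Real.log (pairFieldDecayConst dWaveFormFactor / c) + 1 ≤ K :=
    ⟨max 1 (Real.log (pairFieldDecayConst dWaveFormFactor / c) + 1), le_max_left _ _,
      le_max_right _ _⟩
  have hK0 : 0 < K := by linarith
  have hκ0 : (0 : ℝ) < 1 / (256 * K) := by positivity
  have hinv : 1 / (256 * (1 / (256 * K))) = K := by field_simp
  have hexpK : pairFieldDecayConst dWaveFormFactor * Real.exp (-(1 / (256 * (1 / (256 * K))))) <
      c := by
    rw [hinv]
    rcases hC0.eq_or_lt with h0 | hCpos
    · rw [← h0, zero_mul]; exact hc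
    · have : Real.exp (-K) < c / pairFieldDecayConst dWaveFormFactor := by
        calc Real.exp (-K)
            ≤ Real.exp (-(Real.log (pairFieldDecayConst dWaveFormFactor / c) + 1)) :=
              Real.exp_le_exp.mpr (neg_le_neg hKlog)
          _ < Real.exp (-Real.log (pairFieldDecayConst dWaveFormFactor / c)) :=
              Real.exp_lt_exp.mpr (by linarith)
          _ = c / pairFieldDecayConst dWaveFormFactor := by
              rw [Real.exp_neg, Real.exp_log (by positivity), inv_div]
      calc pairFieldDecayConst dWaveFormFactor * Real.exp (-K)
          < pairFieldDecayConst dWaveFormFactor * (c / pairFieldDecayConst dWaveFormFactor) :=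
            mul_lt_mul_of_pos_left this hCpos
        _ = c := by field_simp
  obtain ⟨L₀, hL₀⟩ := h (1 / (256 * K)) hκ0
  have hUmid : (U₁ + U₂) / 2 ∈ Set.Ioo U₁ U₂ := ⟨by linarith, by linarith⟩
  have h' : ∃ L₀ : ℕ, ∀ (L : ℕ) [NeZero L], L₀ ≤ L → Even L →
      c * (L : ℝ) ^ 4 ≤ (Matrix.gibbsState (1 / (256 * K) * Real.log L)
        ((hubbardTorus 2 L 1 ((U₁ + U₂) / 2)).toBlock
          ((fun (n : ℕ) (s : Finset (Orb (FermionTorus 2 n))) =>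
              s.card = 2 * ⌊(1 - δ) * (n : ℝ) ^ 2 / 2⌋₊ ∧
                2 * (s.filter fun i => (ofLex i).2 = 0).card = 2 * ⌊(1 - δ) * (n : ℝ) ^ 2 / 2⌋₊) L)
          ((fun (n : ℕ) (s : Finset (Orb (FermionTorus 2 n))) =>
              s.card = 2 * ⌊(1 - δ) * (n : ℝ) ^ 2 / 2⌋₊ ∧
                2 * (s.filter fun i => (ofLex i).2 = 0).card = 2 * ⌊(1 - δ) * (n : ℝ) ^ 2 / 2⌋₊) L))
        (((pairField dWaveFormFactor L)ᴴ * pairField dWaveFormFactor L).toBlock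
          ((fun (n : ℕ) (s : Finset (Orb (FermionTorus 2 n))) =>
              s.card = 2 * ⌊(1 - δ) * (n : ℝ) ^ 2 / 2⌋₊ ∧
                2 * (s.filter fun i => (ofLex i).2 = 0).card = 2 * ⌊(1 - δ) * (n : ℝ) ^ 2 / 2⌋₊) L)
          ((fun (n : ℕ) (s : Finset (Orb (FermionTorus 2 n))) =>
              s.card = 2 * ⌊(1 - δ) * (n : ℝ) ^ 2 / 2⌋₊ ∧
                2 * (s.filter fun i => (ofLex i).2 = 0).card = 2 * ⌊(1 - δ) * (n : ℝ) ^ 2 / 2⌋₊) L))).re := by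
    obtain ⟨L₀, hL₀⟩ := h (1 / (256 * K)) hκ0
    exact ⟨L₀, fun L _ hL hev => hL₀ _ hUmid L hL hev⟩
  have hle := logColdSector_orderConstant_le
    (fun (n : ℕ) (s : Finset (Orb (FermionTorus 2 n))) =>
      s.card = 2 * ⌊(1 - δ) * (n : ℝ) ^ 2 / 2⌋₊ ∧
        2 * (s.filter fun i => (ofLex i).2 = 0).card = 2 * ⌊(1 - δ) * (n : ℝ) ^ 2 / 2⌋₊)
    ((U₁ + U₂) / 2) (1 / (256 * K)) c hκ0 h'
  exact absurd (hle.trans_lt hexpK) (lt_irrefl c)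

open scoped Classical in
/-- **No log-cold order at FIXED temperature** (refuted variant; the canonical positive-temperature
no-go in the crux's exact vocabulary): replacing `β_L = κ log L` by a fixed `β ≥ 0` in the body of
`LogColdDWaveOrder` gives a false statement, for every `δ`, every window and every `c > 0`
(`logColdSector_noFixedBetaOrder`). [cite: KomaTasakiPRL1992, Theorem eq. (2)–(3)] -/
theorem logColdDWaveOrder_false_at_fixed_beta :
    ¬ ∃ δ : ℝ, ∃ U₁ U₂ : ℝ, U₁ < U₂ ∧ ∃ β c : ℝ, 0 ≤ β ∧ 0 < c ∧ ∃ L₀ : ℕ,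
      ∀ U ∈ Set.Ioo U₁ U₂, ∀ (L : ℕ) [NeZero L], L₀ ≤ L → Even L →
        let p : Finset (Orb (FermionTorus 2 L)) → Prop := fun s =>
          s.card = 2 * ⌊(1 - δ) * (L : ℝ) ^ 2 / 2⌋₊ ∧
            2 * (s.filter fun i => (ofLex i).2 = 0).card = 2 * ⌊(1 - δ) * (L : ℝ) ^ 2 / 2⌋₊;
        c * (L : ℝ) ^ 4 ≤ (Matrix.gibbsState β ((hubbardTorus 2 L 1 U).toBlock p p)
          (((pairField dWaveFormFactor L)ᴴ * pairField dWaveFormFactor L).toBlock p p)).re := by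
  rintro ⟨δ, U₁, U₂, hU, β, c, hβ, hc, L₀, h⟩
  obtain ⟨L₁, hL₁⟩ := logColdSector_noFixedBetaOrder c β hc hβ
  -- one even side beyond both thresholds, the middle of the window
  obtain ⟨L, hLL₀, hLL₁, hL1, hev⟩ : ∃ L : ℕ, L₀ ≤ L ∧ L₁ ≤ L ∧ 1 ≤ L ∧ Even L :=
    ⟨2 * (L₀ + L₁ + 1), by omega, by omega, by omega, ⟨L₀ + L₁ + 1, by ring⟩⟩
  haveI : NeZero L := ⟨by omega⟩
  have hUmid : (U₁ + U₂) / 2 ∈ Set.Ioo U₁ U₂ := ⟨by linarith, by linarith⟩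
  have h1 := h _ hUmid L hLL₀ hev
  have h2 := hL₁ ((U₁ + U₂) / 2) L hLL₁
    (fun s : Finset (Orb (FermionTorus 2 L)) =>
      s.card = 2 * ⌊(1 - δ) * (L : ℝ) ^ 2 / 2⌋₊ ∧
        2 * (s.filter fun i => (ofLex i).2 = 0).card = 2 * ⌊(1 - δ) * (L : ℝ) ^ 2 / 2⌋₊)
  exact absurd h1 (not_le.mpr h2)

open scoped Classical in
/-- **Sub-logarithmic cooling is not enough** (refuted variant; `log L` is the sharp scale, the
canonical twin of support `LogScaleNecessity` in the crux's vocabulary): if the inverse temperatures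
`b_L ≥ 0` satisfy `b_L / log L → 0`, then `c·L⁴ ≤ Re ω^{sec}_{b_L, L}(Δ_d†Δ_d)` eventually in even `L`
is false for every `δ`, window and `c > 0` (`logColdSector_logScaleNecessity`).
[cite: KomaTasakiPRL1992, Theorem eq. (2)–(3) and p. 3] -/
theorem logColdDWaveOrder_false_below_logScale :
    ¬ ∃ δ : ℝ, ∃ U₁ U₂ : ℝ, U₁ < U₂ ∧ ∃ b : ℕ → ℝ, (∀ L, 0 ≤ b L) ∧
      Tendsto (fun L : ℕ => b L / Real.log L) atTop (𝓝 0) ∧ ∃ c : ℝ, 0 < c ∧ ∃ L₀ : ℕ,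
      ∀ U ∈ Set.Ioo U₁ U₂, ∀ (L : ℕ) [NeZero L], L₀ ≤ L → Even L →
        let p : Finset (Orb (FermionTorus 2 L)) → Prop := fun s =>
          s.card = 2 * ⌊(1 - δ) * (L : ℝ) ^ 2 / 2⌋₊ ∧
            2 * (s.filter fun i => (ofLex i).2 = 0).card = 2 * ⌊(1 - δ) * (L : ℝ) ^ 2 / 2⌋₊;
        c * (L : ℝ) ^ 4 ≤ (Matrix.gibbsState (b L) ((hubbardTorus 2 L 1 U).toBlock p p)
          (((pairField dWaveFormFactor L)ᴴ * pairField dWaveFormFactor L).toBlock p p)).re := by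
  rintro ⟨δ, U₁, U₂, hU, b, hb0, hb, c, hc, L₀, h⟩
  obtain ⟨κ₁, hκ₁, L₁, hL₁⟩ := logColdSector_logScaleNecessity c hc
  -- eventually `b L / log L < κ₁`
  have hev : ∀ᶠ L : ℕ in atTop, b L / Real.log L < κ₁ :=
    (tendsto_order.1 hb).2 κ₁ hκ₁
  obtain ⟨L₂, hL₂⟩ := eventually_atTop.1 hev
  obtain ⟨L, hLL₀, hLL₁, hLL₂, hL3, hevL⟩ :
      ∃ L : ℕ, L₀ ≤ L ∧ L₁ ≤ L ∧ L₂ ≤ L ∧ 3 ≤ L ∧ Even L :=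
    ⟨2 * (L₀ + L₁ + L₂ + 2), by omega, by omega, by omega, by omega, ⟨L₀ + L₁ + L₂ + 2, by ring⟩⟩
  haveI : NeZero L := ⟨by omega⟩
  have hUmid : (U₁ + U₂) / 2 ∈ Set.Ioo U₁ U₂ := ⟨by linarith, by linarith⟩
  have h1 := h _ hUmid L hLL₀ hevL
  have h2 := hL₁ ((U₁ + U₂) / 2) L hLL₁
    (fun s : Finset (Orb (FermionTorus 2 L)) =>
      s.card = 2 * ⌊(1 - δ) * (L : ℝ) ^ 2 / 2⌋₊ ∧
        2 * (s.filter fun i => (ofLex i).2 = 0).card = 2 * ⌊(1 - δ) * (L : ℝ) ^ 2 / 2⌋₊)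
    (b L) (hb0 L) h1
  have h3 := hL₂ L hLL₂
  have hlog : 0 < Real.log L := Real.log_pos (by exact_mod_cast (show 1 < L by omega))
  rw [div_lt_iff₀ hlog] at h3
  linarith

end Summit.HubbardSuperconductivity.HubbardSuperconductivity.Theorems.LogColdTorus

end
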